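import Literature.Probability.RandomPlanarGeometry.SAWHalfSpaceCylinders
import Literature.Probability.RandomPlanarGeometry.SAWHalfSpaceTwoStepRate
import HarnessLib

/-!
# The infinite half-space self-avoiding walk is Kesten's bridge measure: `P^H_{m,n}(ω) → P^B_m(ω)`
# (Lawler–Schramm–Werner 2004, Appendix; every `ℤ^{d+2}`)

Topic `Literature/Probability/RandomPlanarGeometry`, on top of `SAWHalfSpaceCylinders.lean` (the decomposition
`|F_n(ω) ∩ H_n| = Σ_{k=m}^{n} |E_k(ω)| h_{n-k} + R_n(ω)` and `Σ_ω |F_n(ω) ∩ H_n| = h_n`), `SAWKestenBridgeMeasure.lean`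
(lit: the model-free proof `MS831.*` of Madras–Slade Theorem 8.3.1, Kesten's cylinder weight `kestenCyl`),
`SAWHalfSpaceTwoStepRate.lean` (`Zd.LawlerSchrammWerner2004_eqA3 : h_{N+1}/h_N → μ`) and `SAWHalfSpaceConcat.lean`
(the renewal INEQUALITY `Σ_{j=1}^{n} λ_j h_{n-j} ≤ h_n`).

Source: G. F. Lawler, O. Schramm, W. Werner, *On the scaling limit of planar self-avoiding walk* (2004), Appendix
"The infinite half-space SAW" (arXiv:math/0204277, p. 18): "we establish rigorously the existence of the infinite
half-space SAW in all dimensions `d` … the weak limit `lim μ_n` … exists" and it "is the same as the limit measure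
for bridges" (Kesten's measure, Madras–Slade Theorem 8.3.1: `P^B_m(ω) = Σ_k |E_k(ω)| μ^{-k}`, (8.3.6)); the printed
argument is the renewal inequality + lim sup + (A.2)/(A.3). What is proved here (lane pcv-sawmu, planner route
R27, item R27.6, qualitative layer L2): (i) the model-free Theorem-8.3.1 machinery of `SAWKestenBridgeMeasure.lean`
with the renewal EQUATION weakened to the renewal INEQUALITY `Σ_{s=1}^{n} λ_s b_{n-s} ≤ b_n` (all that half-space walks
satisfy): `MS831.tendsto_cylinder_of_le`; (ii) on `ℤ^{d+2}`, for an `m`-step self-avoiding `ω` (`m ≥ 1`): the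
main term `(Σ_{k=m}^{n} |E_k(ω)| h_{n-k})/h_n → P^B_m(ω)`, the remainder `#{η ∈ H_n : no half-space renewal in
[m,n]}/h_n → 0` (its complement has relative mass `→ Σ_ω P^B_m(ω) = 1`), hence **`P^H_{m,n}(ω) :=
|F_n(ω) ∩ H_n|/h_n → P^B_m(ω) = kestenCyl`** — GIVEN, as hypotheses in exactly the shapes filed by the lane for
bridges (`Zd.eCount_le_sum_irreducibleBridgeCount`, `Zd.sum_kestenCyl_eq_one` of `SAWKestenBridgeIdentities.lean`,
in review at the time of writing), the pointwise (8.3.8) bound and the normalisation `Σ_{ω ∈ S_m} P^B_m(ω) = 1`.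
The RATE version (the lane's R27.6: `K(m+1)/log n` in total variation) is not in this file. AXIOMS: standard.

## Contents, all PROVED
* `MS831.sum_shift_tail_le_of_le`, `MS831.sum_tail_le_of_le`, **`MS831.tendsto_cylinder_of_le`** (model-free);
* `Zd.tendsto_halfSpace_cylinder_main` — the main term; `Zd.halfSpaceCount_eq_sum_add_noRenewal_total` —
  `h_n = Σ_k ẽ_k h_{n-k} + R_n` with `ẽ_k = Σ_ω |E_k(ω)|`; `Zd.tendsto_halfSpace_noRenewal_div` — `R_n/h_n → 0`;
* **`Zd.LawlerSchrammWerner2004_halfSpace_limit_of`** — `|F_n(ω) ∩ H_n|/h_n → kestenCyl (d+2) m ω`.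
-/

noncomputable section

open Filter Topology Finset Literature.Probability.LatticeModels
open scoped BigOperators

namespace Literature.Probability.RandomPlanarGeometry.SAW

/-! ## 1. Theorem 8.3.1's machinery under the renewal INEQUALITY -/

namespace MS831

variable {b lam e : ℕ → ℝ} {μ : ℝ} {m : ℕ}

/-- (8.3.9), inner step, under the renewal INEQUALITY `Σ_{s=1}^{N} λ_s b_{N-s} ≤ b_N`: for `i ≤ m`, `J = m+T`,
`n ≥ J+1`, `Σ_{k=J+1}^{n} λ_{k-i} b_{n-k} ≤ b_{n-i} - Σ_{r=0}^{J-m} λ_r b_{n-i-r}`.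
[cite: MadrasSlade1993, Theorem 8.3.1 (proof, eq. (8.3.9)); LawlerSchrammWerner2004SAW, Appendix ("υ_n ≥ Σ_{j=1}^{k} λ_j υ_{n-j}")] -/
theorem sum_shift_tail_le_of_le (hb : ∀ n, 0 < b n) (hlam : ∀ j, 0 ≤ lam j) (hlam0 : lam 0 = 0)
    (hren : ∀ n, 1 ≤ n → ∑ s ∈ Icc 1 n, lam s * b (n - s) ≤ b n) {T n i : ℕ} (hi : i ≤ m)
    (hn : m + T + 1 ≤ n) :
    ∑ k ∈ Ico (m + T + 1) (n + 1), lam (k - i) * b (n - k) ≤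
      b (n - i) - ∑ r ∈ range (T + 1), lam r * b (n - i - r) := by
  -- reindex `k = r + i`
  have hre : ∑ k ∈ Ico (m + T + 1) (n + 1), lam (k - i) * b (n - k) =
      ∑ r ∈ Ico (m + T + 1 - i) (n + 1 - i), lam r * b (n - i - r) := by
    refine Finset.sum_nbij' (fun k => k - i) (fun r => r + i) ?_ ?_ ?_ ?_ ?_
    · intro k hk
      simp only [mem_Ico] at hk ⊢
      omega
    · intro r hr
      simp only [mem_Ico] at hr ⊢
      omega
    · intro k hk
      simp only [mem_Ico] at hk
      show k - i + i = k
      omega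
    · intro r hr
      show r + i - i = r
      omega
    · intro k hk
      simp only [mem_Ico] at hk
      show lam (k - i) * b (n - k) = lam (k - i) * b (n - i - (k - i))
      rw [show n - i - (k - i) = n - k by omega]
  rw [hre]
  -- enlarge the range of `r` down to `T + 1`
  have hsub : Ico (m + T + 1 - i) (n + 1 - i) ⊆ Ico (T + 1) (n - i + 1) := by
    intro r hr
    simp only [mem_Ico] at hr ⊢
    omega
  refine (Finset.sum_le_sum_of_subset_of_nonneg hsub fun r _ _ =>
    mul_nonneg (hlam r) (hb _).le).trans ?_
  -- the renewal inequality at `N = n - i`, with the vanishing `s = 0` term added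
  have hN : 1 ≤ n - i := by omega
  have hfull : ∑ s ∈ Ico 0 (n - i + 1), lam s * b (n - i - s) ≤ b (n - i) := by
    rw [← sum_Ico_consecutive _ (Nat.zero_le 1) (by omega : 1 ≤ n - i + 1), ← Finset.range_eq_Ico,
      sum_range_one, hlam0, zero_mul, zero_add, ← Icc_eq_Ico_succ]
    exact hren (n - i) hN
  rw [← sum_Ico_consecutive _ (Nat.zero_le (T + 1)) (by omega : T + 1 ≤ n - i + 1),
    ← Finset.range_eq_Ico] at hfull
  linarith

/-- **(8.3.9) under the renewal INEQUALITY**: for `J = m + T` and `n ≥ J + 1`,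
`Σ_{k=m}^{n} e_k b_{n-k} ≤ Σ_{k=m}^{J} e_k b_{n-k} + Σ_{i=0}^{m} (b_{n-i} - Σ_{r=0}^{J-m} λ_r b_{n-i-r})`.
[cite: MadrasSlade1993, Theorem 8.3.1 (proof, eq. (8.3.9)); LawlerSchrammWerner2004SAW, Appendix] -/
theorem sum_tail_le_of_le (hb : ∀ n, 0 < b n) (hlam : ∀ j, 0 ≤ lam j) (hlam0 : lam 0 = 0)
    (hren : ∀ n, 1 ≤ n → ∑ s ∈ Icc 1 n, lam s * b (n - s) ≤ b n)
    (h838 : ∀ k, m ≤ k → e k ≤ ∑ i ∈ range (m + 1), lam (k - i)) {T n : ℕ}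
    (hn : m + T + 1 ≤ n) :
    ∑ k ∈ Icc m n, e k * b (n - k) ≤
      ∑ k ∈ Icc m (m + T), e k * b (n - k) +
        ∑ i ∈ range (m + 1), (b (n - i) - ∑ r ∈ range (T + 1), lam r * b (n - i - r)) := by
  rw [Icc_eq_Ico_succ, Icc_eq_Ico_succ,
    ← sum_Ico_consecutive _ (by omega : m ≤ m + T + 1) (by omega : m + T + 1 ≤ n + 1)]
  refine add_le_add le_rfl ?_
  calc ∑ k ∈ Ico (m + T + 1) (n + 1), e k * b (n - k)
      ≤ ∑ k ∈ Ico (m + T + 1) (n + 1), (∑ i ∈ range (m + 1), lam (k - i)) * b (n - k) := by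
        refine Finset.sum_le_sum fun k hk => ?_
        simp only [mem_Ico] at hk
        exact mul_le_mul_of_nonneg_right (h838 k (by omega)) (hb _).le
    _ = ∑ i ∈ range (m + 1), ∑ k ∈ Ico (m + T + 1) (n + 1), lam (k - i) * b (n - k) := by
        rw [Finset.sum_comm]
        refine Finset.sum_congr rfl fun k _ => ?_
        rw [Finset.sum_mul]
    _ ≤ ∑ i ∈ range (m + 1), (b (n - i) - ∑ r ∈ range (T + 1), lam r * b (n - i - r)) := by
        refine Finset.sum_le_sum fun i hi => ?_
        simp only [mem_range] at hi
        exact sum_shift_tail_le_of_le hb hlam hlam0 hren (by omega) hn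

/-- **Theorem 8.3.1's convergence, model-free, under the renewal INEQUALITY** `Σ_{s=1}^{n} λ_s b_{n-s} ≤ b_n`
(instead of the bridge renewal equation): with `b_{n+1}/b_n → μ > 0`, `λ ≥ 0`, `λ_0 = 0`, `Σ_k λ_k μ^{-k} = 1`,
`e ≥ 0` vanishing below `m`, (8.3.8) `e_k ≤ Σ_{i≤m} λ_{k-i}`: `(Σ_{k=m}^{n} e_k b_{n-k})/b_n → Σ_k e_k μ^{-k}`.
[cite: MadrasSlade1993, Theorem 8.3.1 and its proof, eqs. (8.3.5)–(8.3.11); LawlerSchrammWerner2004SAW, Appendix] -/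
theorem tendsto_cylinder_of_le (hμ : 0 < μ) (hb : ∀ n, 0 < b n) (hlam : ∀ j, 0 ≤ lam j)
    (hlam0 : lam 0 = 0) (hK : HasSum (fun k => lam k / μ ^ k) 1)
    (hren : ∀ n, 1 ≤ n → ∑ s ∈ Icc 1 n, lam s * b (n - s) ≤ b n)
    (hratio : Tendsto (fun n => b (n + 1) / b n) atTop (𝓝 μ))
    (he : ∀ k, 0 ≤ e k) (he0 : ∀ k, k < m → e k = 0)
    (h838 : ∀ k, m ≤ k → e k ≤ ∑ i ∈ range (m + 1), lam (k - i)) :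
    Tendsto (fun n => (∑ k ∈ Icc m n, e k * b (n - k)) / b n) atTop
      (𝓝 (∑' k, e k / μ ^ k)) := by
  have hs := summable_e hμ hlam hK he he0 h838
  set S := ∑' k, e k / μ ^ k with hSdef
  have hST := tendsto_partial he0 hs
  have hRT := tendsto_remainder (m := m) (μ := μ) hK
  rw [tendsto_order]
  refine ⟨fun a ha => ?_, fun c hc => ?_⟩
  · obtain ⟨T, hT⟩ := (hST.eventually_const_lt ha).exists
    have hlow := (tendsto_lower (e := e) (m := m) hb hμ hratio T).eventually_const_lt hT
    filter_upwards [hlow, eventually_ge_atTop (m + T)] with n hn hnT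
    refine lt_of_lt_of_le hn ?_
    exact div_le_div_of_nonneg_right (sum_trunc_le hb he hnT) (hb n).le
  · have hsum : Tendsto (fun T => ∑ k ∈ Icc m (m + T), e k * μ⁻¹ ^ k +
        ∑ i ∈ range (m + 1), (μ⁻¹ ^ i - ∑ r ∈ range (T + 1), lam r * μ⁻¹ ^ (i + r)))
        atTop (𝓝 (S + 0)) := hST.add hRT
    rw [add_zero] at hsum
    obtain ⟨T, hT⟩ := (hsum.eventually_lt_const hc).exists
    have hup := ((tendsto_lower (e := e) (m := m) hb hμ hratio T).add
      (tendsto_upper (lam := lam) (m := m) hb hμ hratio T)).eventually_lt_const hT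
    filter_upwards [hup, eventually_ge_atTop (m + T + 1)] with n hn hnT
    refine lt_of_le_of_lt ?_ hn
    rw [← add_div]
    exact div_le_div_of_nonneg_right (sum_tail_le_of_le hb hlam hlam0 hren h838 hnT) (hb n).le

end MS831

/-! ## 2. Half-space walks on `ℤ^{d+2}` -/

namespace Zd

variable {d : ℕ}

/-- **The main term**: for an `m`-step self-avoiding `ω` satisfying the pointwise (8.3.8) bound,
`(Σ_{k=m}^{n} |E_k(ω)| h_{n-k})/h_n → P^B_m(ω) = kestenCyl` (Theorem 8.3.1's machinery with `b ↦ h`: the renewal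
inequality `Zd.sum_irreducibleBridgeCount_mul_halfSpaceCount_le`, (A.3) `Zd.LawlerSchrammWerner2004_eqA3`, Kesten's
relation `MadrasSlade1993_eq424_holds`).
[cite: LawlerSchrammWerner2004SAW, Appendix ("the same as the limit measure for bridges"); MadrasSlade1993, Theorem 8.3.1] -/
theorem tendsto_halfSpace_cylinder_main {m : ℕ} {ω : ℕ → Site (d + 2)} (hω : ω ∈ saws (d + 2) m)
    (h838 : ∀ k, m ≤ k → eCount (d + 2) k m ω ≤ ∑ i ∈ range m, irreducibleBridgeCount (d + 2) (k - i)) :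
    Tendsto (fun n => (∑ k ∈ Icc m n, (eCount (d + 2) k m ω : ℝ) * (halfSpaceCount (d + 2) (n - k) : ℝ)) /
      (halfSpaceCount (d + 2) n : ℝ)) atTop (𝓝 (kestenCyl (d + 2) m ω)) := by
  have hμ := connectiveConstant_pos (d + 2)
  have hh : ∀ n, (0 : ℝ) < (halfSpaceCount (d + 2) n : ℝ) := fun n => by
    exact_mod_cast one_le_halfSpaceCount (d := d + 2) n
  have hlam : ∀ j, (0 : ℝ) ≤ (irreducibleBridgeCount (d + 2) j : ℝ) := fun j => Nat.cast_nonneg _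
  have hlam0 : ((irreducibleBridgeCount (d + 2) 0 : ℕ) : ℝ) = 0 := by
    rw [irreducibleBridgeCount_zero, Nat.cast_zero]
  have hK := MadrasSlade1993_eq424_holds (d + 2)
  have hren : ∀ n, 1 ≤ n → ∑ s ∈ Icc 1 n, (irreducibleBridgeCount (d + 2) s : ℝ) *
      (halfSpaceCount (d + 2) (n - s) : ℝ) ≤ (halfSpaceCount (d + 2) n : ℝ) :=
    fun n _ => by exact_mod_cast sum_irreducibleBridgeCount_mul_halfSpaceCount_le (d := d + 2) n
  have hratio := LawlerSchrammWerner2004_eqA3 d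
  have he : ∀ k, (0 : ℝ) ≤ (eCount (d + 2) k m ω : ℝ) := fun k => Nat.cast_nonneg _
  have he0 : ∀ k, k < m → ((eCount (d + 2) k m ω : ℕ) : ℝ) = 0 := fun k hk => by
    rw [eCount_eq_zero_of_lt hω hk, Nat.cast_zero]
  have h838' : ∀ k, m ≤ k → (eCount (d + 2) k m ω : ℝ) ≤
      ∑ i ∈ range (m + 1), (irreducibleBridgeCount (d + 2) (k - i) : ℝ) := by
    intro k hk
    have h1 : (eCount (d + 2) k m ω : ℝ) ≤ ∑ i ∈ range m, (irreducibleBridgeCount (d + 2) (k - i) : ℝ) := by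
      exact_mod_cast h838 k hk
    refine h1.trans ?_
    rw [Finset.sum_range_succ]
    linarith [hlam (k - m)]
  have key := MS831.tendsto_cylinder_of_le (m := m) hμ hh hlam hlam0 hK hren hratio he he0 h838'
  rw [kestenCyl_eq_tsum_div]
  exact key

open Classical in
/-- **Totals**: for `m ≤ n`, `h_n = Σ_{k=m}^{n} ẽ_k h_{n-k} + R_n` with `ẽ_k = Σ_{ω ∈ S_m} |E_k(ω)|` and
`R_n = #{η ∈ H_n : no half-space renewal time in [m, n]}` (sum the decomposition over the cylinders).
[cite: MadrasSlade1993, Theorem 8.3.1 (proof, eq. (8.3.5)); LawlerSchrammWerner2004SAW, Appendix] -/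
theorem halfSpaceCount_eq_sum_add_noRenewal_total [NeZero d] {n m : ℕ} (hmn : m ≤ n) :
    (halfSpaceCount d n : ℝ) =
      ∑ k ∈ Icc m n, (∑ ω ∈ saws d m, (eCount d k m ω : ℝ)) * (halfSpaceCount d (n - k) : ℝ) +
        (((halfSpaceWalks d n).filter fun η : ℕ → Site d =>
          ∀ i, m ≤ i → i ≤ n → ¬ IsHalfSpaceRenewalTime n η i).card : ℝ) := by
  classical
  rw [← sum_halfSpaceExtCount_eq (d := d) hmn, ← sum_halfSpaceNoRenewalCount_eq (d := d) hmn]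
  push_cast
  rw [Finset.sum_congr rfl fun ω hω => by
    rw [halfSpaceExtCount_eq_sum_add_noRenewal (d := d) (n := n) hω]]
  push_cast
  rw [Finset.sum_add_distrib, Finset.sum_comm]
  congr 1
  refine Finset.sum_congr rfl fun k _ => ?_
  rw [Finset.sum_mul]

open Classical in
/-- **The remainder is negligible**: given (8.3.8) for every `m`-cylinder and the normalisation
`Σ_{ω ∈ S_m} P^B_m(ω) = 1` (`m ≥ 1`), `R_n/h_n → 0` — since `(Σ_k ẽ_k h_{n-k})/h_n → Σ_k ẽ_k μ^{-k} = Σ_ω P^B_m(ω) = 1`.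
[cite: LawlerSchrammWerner2004SAW, Appendix; MadrasSlade1993, Theorem 8.3.1 (proof) and p. 273 (consistency of the P^B_m)] -/
theorem tendsto_halfSpace_noRenewal_div {m : ℕ}
    (h838 : ∀ ω ∈ saws (d + 2) m, ∀ k, m ≤ k →
      eCount (d + 2) k m ω ≤ ∑ i ∈ range m, irreducibleBridgeCount (d + 2) (k - i))
    (hnorm : ∑ ω ∈ saws (d + 2) m, kestenCyl (d + 2) m ω = 1) :
    Tendsto (fun n => (((halfSpaceWalks (d + 2) n).filter fun η : ℕ → Site (d + 2) =>
        ∀ i, m ≤ i → i ≤ n → ¬ IsHalfSpaceRenewalTime n η i).card : ℝ) / (halfSpaceCount (d + 2) n : ℝ))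
      atTop (𝓝 0) := by
  classical
  have hμ := connectiveConstant_pos (d + 2)
  set μ := connectiveConstant (d + 2) with hμdef
  have hh : ∀ n, (0 : ℝ) < (halfSpaceCount (d + 2) n : ℝ) := fun n => by
    exact_mod_cast one_le_halfSpaceCount (d := d + 2) n
  have hlam : ∀ j, (0 : ℝ) ≤ (irreducibleBridgeCount (d + 2) j : ℝ) := fun j => Nat.cast_nonneg _
  have hlam0 : ((irreducibleBridgeCount (d + 2) 0 : ℕ) : ℝ) = 0 := by
    rw [irreducibleBridgeCount_zero, Nat.cast_zero]
  have hK := MadrasSlade1993_eq424_holds (d + 2)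
  have hren : ∀ n, 1 ≤ n → ∑ s ∈ Icc 1 n, (irreducibleBridgeCount (d + 2) s : ℝ) *
      (halfSpaceCount (d + 2) (n - s) : ℝ) ≤ (halfSpaceCount (d + 2) n : ℝ) :=
    fun n _ => by exact_mod_cast sum_irreducibleBridgeCount_mul_halfSpaceCount_le (d := d + 2) n
  have hratio := LawlerSchrammWerner2004_eqA3 d
  -- the summed cylinder counts, scaled by `C = c_m`
  set C : ℝ := (count (d + 2) m : ℝ) with hC
  have hC0 : 0 < C := by rw [hC]; exact_mod_cast one_le_count (d + 2) m
  have hcardS : ((saws (d + 2) m).card : ℝ) = C := by rw [hC, card_saws]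
  set et : ℕ → ℝ := fun k => ∑ ω ∈ saws (d + 2) m, (eCount (d + 2) k m ω : ℝ) with het
  set e : ℕ → ℝ := fun k => et k / C with hedef
  have he : ∀ k, 0 ≤ e k := fun k => div_nonneg (Finset.sum_nonneg fun _ _ => Nat.cast_nonneg _) hC0.le
  have he0 : ∀ k, k < m → e k = 0 := by
    intro k hk
    simp only [hedef, het]
    rw [Finset.sum_eq_zero fun ω hω => by rw [eCount_eq_zero_of_lt hω hk, Nat.cast_zero], zero_div]
  have h838' : ∀ k, m ≤ k → e k ≤ ∑ i ∈ range (m + 1), (irreducibleBridgeCount (d + 2) (k - i) : ℝ) := by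
    intro k hk
    have hsumle : et k ≤ C * ∑ i ∈ range m, (irreducibleBridgeCount (d + 2) (k - i) : ℝ) := by
      simp only [het]
      calc ∑ ω ∈ saws (d + 2) m, (eCount (d + 2) k m ω : ℝ)
          ≤ ∑ _ω ∈ saws (d + 2) m, ∑ i ∈ range m, (irreducibleBridgeCount (d + 2) (k - i) : ℝ) :=
            Finset.sum_le_sum fun ω hω => by exact_mod_cast h838 ω hω k hk
        _ = C * ∑ i ∈ range m, (irreducibleBridgeCount (d + 2) (k - i) : ℝ) := by
            rw [Finset.sum_const, nsmul_eq_mul, hcardS]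
    have h1 : e k ≤ ∑ i ∈ range m, (irreducibleBridgeCount (d + 2) (k - i) : ℝ) := by
      simp only [hedef]
      rw [div_le_iff₀ hC0]
      linarith
    refine h1.trans ?_
    rw [Finset.sum_range_succ]
    linarith [hlam (k - m)]
  -- the scaled main limit: `(Σ_k e_k h_{n-k})/h_n → Σ' e_k/μ^k`
  have key := MS831.tendsto_cylinder_of_le (m := m) hμ hh hlam hlam0 hK hren hratio he he0 h838'
  -- identify `Σ' e_k/μ^k = 1/C`
  have hsumm : ∀ ω ∈ saws (d + 2) m, Summable (fun k => (eCount (d + 2) k m ω : ℝ) / μ ^ k) := by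
    intro ω hω
    have he' : ∀ k, (0 : ℝ) ≤ (eCount (d + 2) k m ω : ℝ) := fun k => Nat.cast_nonneg _
    have he0' : ∀ k, k < m → ((eCount (d + 2) k m ω : ℕ) : ℝ) = 0 := fun k hk => by
      rw [eCount_eq_zero_of_lt hω hk, Nat.cast_zero]
    have h838ω : ∀ k, m ≤ k → (eCount (d + 2) k m ω : ℝ) ≤
        ∑ i ∈ range (m + 1), (irreducibleBridgeCount (d + 2) (k - i) : ℝ) := by
      intro k hk
      have h1 : (eCount (d + 2) k m ω : ℝ) ≤ ∑ i ∈ range m, (irreducibleBridgeCount (d + 2) (k - i) : ℝ) := by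
        exact_mod_cast h838 ω hω k hk
      refine h1.trans ?_
      rw [Finset.sum_range_succ]
      linarith [hlam (k - m)]
    exact MS831.summable_e hμ hlam hK he' he0' h838ω
  have htot : HasSum (fun k => et k / μ ^ k) 1 := by
    have h1 : HasSum (fun k => ∑ ω ∈ saws (d + 2) m, (eCount (d + 2) k m ω : ℝ) / μ ^ k)
        (∑ ω ∈ saws (d + 2) m, kestenCyl (d + 2) m ω) := by
      refine hasSum_sum fun ω hω => ?_
      rw [kestenCyl_eq_tsum_div]
      exact (hsumm ω hω).hasSum
    rw [hnorm] at h1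
    refine h1.congr_fun fun k => ?_
    simp only [het, Finset.sum_div]
  have hlimval : ∑' k, e k / μ ^ k = 1 / C := by
    have h2 : HasSum (fun k => e k / μ ^ k) (1 / C) := by
      have := htot.div_const C
      refine this.congr_fun fun k => ?_
      simp only [hedef]
      ring
    exact h2.tsum_eq
  rw [hlimval] at key
  -- `R_n/h_n = 1 - C · (Σ_k e_k h_{n-k})/h_n` for `n ≥ m`
  have hmain : Tendsto (fun n => 1 - C * ((∑ k ∈ Icc m n, e k * (halfSpaceCount (d + 2) (n - k) : ℝ)) /
      (halfSpaceCount (d + 2) n : ℝ))) atTop (𝓝 (1 - C * (1 / C))) :=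
    tendsto_const_nhds.sub (key.const_mul C)
  rw [mul_one_div_cancel hC0.ne', sub_self] at hmain
  refine hmain.congr' ?_
  filter_upwards [eventually_ge_atTop m] with n hn
  have htotal := halfSpaceCount_eq_sum_add_noRenewal_total (d := d + 2) (n := n) (m := m) hn
  have hhn := hh n
  rw [eq_div_iff hhn.ne']
  have hsumC : C * (∑ k ∈ Icc m n, e k * (halfSpaceCount (d + 2) (n - k) : ℝ)) =
      ∑ k ∈ Icc m n, et k * (halfSpaceCount (d + 2) (n - k) : ℝ) := by
    rw [Finset.mul_sum]
    refine Finset.sum_congr rfl fun k _ => ?_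
    simp only [hedef]
    field_simp
  have : C * ((∑ k ∈ Icc m n, e k * (halfSpaceCount (d + 2) (n - k) : ℝ)) / (halfSpaceCount (d + 2) n : ℝ)) *
      (halfSpaceCount (d + 2) n : ℝ) = ∑ k ∈ Icc m n, et k * (halfSpaceCount (d + 2) (n - k) : ℝ) := by
    rw [← hsumC]; field_simp
  rw [sub_mul, this, one_mul, htotal]
  simp only [het]
  ring

/-- **Lawler–Schramm–Werner: the infinite half-space SAW is Kesten's bridge measure** — for an `m`-step
self-avoiding walk `ω` on `ℤ^{d+2}` (`m ≥ 1`), the fraction of `n`-step half-space walks extending `ω` converges to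
Kesten's cylinder weight: `|F_n(ω) ∩ H_n| / h_n → P^B_m(ω) = kestenCyl (d+2) m ω` — GIVEN the pointwise (8.3.8)
bound for the `m`-cylinders and the normalisation `Σ_{ω ∈ S_m} P^B_m(ω) = 1` (both proved for the tree in
`SAWKestenBridgeIdentities.lean`, in review at the time of writing; hypotheses in exactly those shapes).
[cite: LawlerSchrammWerner2004SAW, Appendix A, p0018:L5–L9 (statement: "the weak limit as n→∞ of the uniform measure on n-step self avoiding walks in the half-space … exists"), L15–L21 ("the infinite half-space SAW is the same as the limit measure for bridges"), L70–L78 (cylinder limits λ_k β^{−k} and the i.i.d. irreducible-bridge description); MadrasSlade1993, Theorem 8.3.1] -/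
theorem LawlerSchrammWerner2004_halfSpace_limit_of {m : ℕ} {ω : ℕ → Site (d + 2)}
    (hω : ω ∈ saws (d + 2) m)
    (h838 : ∀ ω' ∈ saws (d + 2) m, ∀ k, m ≤ k →
      eCount (d + 2) k m ω' ≤ ∑ i ∈ range m, irreducibleBridgeCount (d + 2) (k - i))
    (hnorm : ∑ ω' ∈ saws (d + 2) m, kestenCyl (d + 2) m ω' = 1) :
    Tendsto (fun n => (halfSpaceExtCount (d + 2) n m ω : ℝ) / (halfSpaceCount (d + 2) n : ℝ)) atTop
      (𝓝 (kestenCyl (d + 2) m ω)) := by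
  classical
  have hh : ∀ n, (0 : ℝ) < (halfSpaceCount (d + 2) n : ℝ) := fun n => by
    exact_mod_cast one_le_halfSpaceCount (d := d + 2) n
  have hmainT := tendsto_halfSpace_cylinder_main hω (h838 ω hω)
  have hremT := tendsto_halfSpace_noRenewal_div (d := d) h838 hnorm
  -- `P^H_{m,n}(ω) = main + R_n(ω)/h_n` with `0 ≤ R_n(ω) ≤ R_n`
  have hdecomp : ∀ n, (halfSpaceExtCount (d + 2) n m ω : ℝ) / (halfSpaceCount (d + 2) n : ℝ) =
      (∑ k ∈ Icc m n, (eCount (d + 2) k m ω : ℝ) * (halfSpaceCount (d + 2) (n - k) : ℝ)) /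
          (halfSpaceCount (d + 2) n : ℝ) +
        (halfSpaceNoRenewalCount (d + 2) n m ω : ℝ) / (halfSpaceCount (d + 2) n : ℝ) := by
    intro n
    rw [halfSpaceExtCount_eq_sum_add_noRenewal (d := d + 2) (n := n) hω]
    push_cast
    rw [add_div]
  have hR : Tendsto (fun n => (halfSpaceNoRenewalCount (d + 2) n m ω : ℝ) / (halfSpaceCount (d + 2) n : ℝ))
      atTop (𝓝 0) := by
    refine tendsto_of_tendsto_of_tendsto_of_le_of_le tendsto_const_nhds hremT (fun n => by positivity)
      (fun n => ?_)
    refine div_le_div_of_nonneg_right ?_ (hh n).le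
    -- `R_n(ω) ≤ R_n`: the defining filter of `R_n(ω)` refines that of `R_n`
    have hle : halfSpaceNoRenewalCount (d + 2) n m ω ≤
        ((halfSpaceWalks (d + 2) n).filter fun η : ℕ → Site (d + 2) =>
          ∀ i, m ≤ i → i ≤ n → ¬ IsHalfSpaceRenewalTime n η i).card := by
      unfold halfSpaceNoRenewalCount
      apply Finset.card_le_card
      intro η hη
      simp only [Finset.mem_filter] at hη ⊢
      exact ⟨hη.1, hη.2.2⟩
    have hle' : (halfSpaceNoRenewalCount (d + 2) n m ω : ℝ) ≤
        (((halfSpaceWalks (d + 2) n).filter fun η : ℕ → Site (d + 2) =>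
          ∀ i, m ≤ i → i ≤ n → ¬ IsHalfSpaceRenewalTime n η i).card : ℝ) := by exact_mod_cast hle
    convert hle' using 4
  have := hmainT.add hR
  rw [add_zero] at this
  exact this.congr fun n => (hdecomp n).symm

end Zd

end Literature.Probability.RandomPlanarGeometry.SAW

end
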